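import Literature.NumberTheory.Sieve.GoldbachLinnikParseval
import Literature.NumberTheory.Sieve.SingularSeries
import HarnessLib

/-!
# Goldbach–Linnik numbers: the arc decomposition of `∫₀¹ |S G^k|²` (Pintz–Ruzsa I, (10.3)–(10.6))

Topic `Literature/NumberTheory/Sieve`; support file for the named fact
`Literature.NumberTheory.Sieve.goldbach_linnik` (parity.S36). Sequel to `GoldbachLinnikParseval.lean`.

Pintz–Ruzsa, *On Linnik's approximation to Goldbach's problem, I*, Acta Arith. 109 (2003), proof
of Lemma 13, (10.3)–(10.6): the mean square `∫₀¹ |S(α) G_k(α)|²` (`G_k = G^k`) is split as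
`∫_𝔐 + ∫_{C(𝔐) ∩ E} + ∫_{C(𝔐) ∖ E}` (major arcs `𝔐`, their complement `C(𝔐)`, and the set `E` of
large values of `G`), and

* (10.4) `∫_𝔐 |S G_k|² = ∑_m r_{k,k}(m) ∫_𝔐 |S(α)|² e(mα) dα ≤ r_{k,k}(0) ∫₀¹ |S|² + ∑_{m ≠ 0} r_{k,k}(m) ∫_𝔐 |S|² e(mα)`,
  where `r_{k,k}(m) = #{2^{ν₁} + ⋯ + 2^{ν_k} - 2^{μ₁} - ⋯ - 2^{μ_k} = m}` ((9.1));
* (10.5) `∫_{C(𝔐) ∖ E} |S G_k|² ≤ ((1-η)L)^{2k-2} ∫_{C(𝔐)} |S G|²` (`|G| ≤ (1-η)L` off `E`);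
* (10.6) `∫_{C(𝔐) ∩ E} |S G_k|² ≤ |E| · (sup_{C(𝔐)} |S|)² · L^{2k}`.

This file proves exactly this bookkeeping, for an ARBITRARY measurable set of "major arcs"
`𝔐 ⊆ ℝ` and an arbitrary measurable exceptional set `E`, at a fixed `N`, with the pointwise bounds
`sup_{[0,1] ∖ 𝔐} |S| ≤ U`, `sup_{[0,1] ∖ E} |G| ≤ λL` as hypotheses
(`meanSquare_le_split`). The sums over `m` are kept as sums over pairs of exponent tuples
(`(ν, μ)` with `∑ 2^{ν_i} = ∑ 2^{μ_i}`, counted by `coincidences N k = r_{k,k}(0)`, resp. `≠`,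
the finset `offDiagPairs N k`), and `∫_𝔐 |S|² e(hα)` is `majorArcPairIntegral 𝔐 N h` (real part;
the left side of Pintz–Ruzsa's Lemma 1, (2.6), and of (8.18)). The analytic inputs of Lemma 13
(Lemma 1 / Part II major arcs, Theorem 4, Lemma 11, Corollaries 1–2, the minor-arc bound (2.10))
enter only in the sequel `GoldbachLinnikMeanSquare.lean`; the two auxiliary sums it and
`GoldbachLinnikMinorArcs.lean` need (`pairSingularSum` = `∑_{m≠0} r_{k,k}(m)σ(m)` of (9.4),
`oddPrimeLogSum` = the log-weighted `S`) are defined here so that the sequels introduce no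
definitions. No named facts are introduced.

## References

* J. Pintz, I. Z. Ruzsa, *On Linnik's approximation to Goldbach's problem, I*, Acta Arith. 109
  (2003) 169–194, (9.1)–(9.2), Lemma 13, (10.3)–(10.6). [PintzRuzsa2003]
-/

noncomputable section

open scoped FourierTransform

open Finset Filter MeasureTheory

namespace Literature.NumberTheory.Sieve

namespace GoldbachLinnik

/-! ### Objects -/

/-- The sum of powers `2^{ν₁} + ⋯ + 2^{ν_k}` of an exponent tuple. [cite: PintzRuzsa2003, (9.1)] -/
def tupleSum {k : ℕ} (ν : Fin k → ℕ) : ℕ := ∑ i, 2 ^ ν i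

/-- `r_{k,k}(0) = #{(ν, μ) ∈ [1,L]^k × [1,L]^k : 2^{ν₁} + ⋯ + 2^{ν_k} = 2^{μ₁} + ⋯ + 2^{μ_k}}`
(Pintz–Ruzsa I (9.1) at `m = 0`, Lemma 12). [cite: PintzRuzsa2003, (9.1)] -/
def coincidences (N k : ℕ) : ℕ :=
  ((expTuples N k ×ˢ expTuples N k).filter fun z => tupleSum z.1 = tupleSum z.2).card

/-- The pairs of exponent tuples with different sums (the terms `m ≠ 0` of `∑_m r_{k,k}(m) …`,
Pintz–Ruzsa I (9.3)–(9.4), (10.4)). [cite: PintzRuzsa2003, (10.4)] -/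
def offDiagPairs (N k : ℕ) : Finset ((Fin k → ℕ) × (Fin k → ℕ)) :=
  (expTuples N k ×ˢ expTuples N k).filter fun z => tupleSum z.1 ≠ tupleSum z.2

/-- `R_𝔐(h) = Re ∫_{[0,1] ∩ 𝔐} |S(α)|² e(hα) dα`, the major-arc contribution to the number of prime
pairs `p - p' = -h` (left side of Pintz–Ruzsa I Lemma 1, (2.6); `R(h) - R₂(h)` in (8.18)); here for
an arbitrary set `𝔐`. [cite: PintzRuzsa2003, (2.6)] -/
def majorArcPairIntegral (𝔐 : Set ℝ) (N : ℕ) (h : ℤ) : ℝ :=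
  (∫ α in Set.Icc (0 : ℝ) 1 ∩ 𝔐, ((‖primeSum N α‖ ^ 2 : ℝ) : ℂ) * (𝐞 ((h : ℝ) * α) : ℂ)).re

/-- `∑_{(ν,μ) : m ≠ 0} σ(|m|)`, `m = ∑2^{ν_i} - ∑2^{μ_i}`, i.e. `∑_{m ≠ 0} r_{k,k}(m) σ(m)`
(the sum `S(k, L)` of Pintz–Ruzsa I (9.4) without its `m = 0` terms; `σ(h) = 2C₀∏_{p∣h,p>2}(p-1)/(p-2)`
for even `h`, `0` for odd `h`, as in (2.7), is the tree's `goldbachSingularSeries |h|`). Used in the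
sequel `GoldbachLinnikMeanSquare.lean` (hypothesis `hA` = Theorem 4). [cite: PintzRuzsa2003, (9.4)] -/
def pairSingularSum (N k : ℕ) : ℝ :=
  ∑ z ∈ offDiagPairs N k, goldbachSingularSeries (((tupleSum z.1 : ℤ) - tupleSum z.2).natAbs)

/-- `A(n) = ∑_{p ≤ n, p odd prime} (log p) e(pα)`, the log-weighted companion of `S(α)` (used for
the partial summation of the sequel `GoldbachLinnikMinorArcs.lean`). [cite: PintzRuzsa2003, (2.4)] -/
def oddPrimeLogSum (n : ℕ) (α : ℝ) : ℂ :=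
  ∑ p ∈ oddPrimes n, (Real.log p : ℂ) * (𝐞 ((p : ℝ) * α) : ℂ)

/-! ### Pointwise facts -/

/-- `S` is continuous. [folklore] -/
theorem continuous_primeSum (N : ℕ) : Continuous (primeSum N) :=
  continuous_finsetSum _ fun _ _ =>
    continuous_subtype_val.comp (Real.continuous_fourierChar.comp (continuous_const.mul continuous_id))

/-- `G` is continuous. [folklore] -/
theorem continuous_powSum (N : ℕ) : Continuous (powSum N) :=
  continuous_finsetSum _ fun _ _ =>
    continuous_subtype_val.comp (Real.continuous_fourierChar.comp (continuous_const.mul continuous_id))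

/-- The character `α ↦ e(cα)` is continuous (as a `ℂ`-valued function). [folklore] -/
theorem continuous_fourierChar_mul (c : ℝ) : Continuous fun α : ℝ => (𝐞 (c * α) : ℂ) :=
  continuous_subtype_val.comp (Real.continuous_fourierChar.comp (continuous_const.mul continuous_id))

/-- The trivial bound `|G(α)| ≤ L`. [cite: PintzRuzsa2003, (10.6)] -/
theorem norm_powSum_le (N : ℕ) (α : ℝ) : ‖powSum N α‖ ≤ powLen N := by
  refine (norm_sum_le _ _).trans (le_of_eq ?_)
  rw [Finset.sum_congr rfl fun p _ => Circle.norm_coe _, Finset.sum_const, nsmul_eq_mul, mul_one,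
    Nat.card_Icc]
  simp

/-- `|G(α)^k|² = ∑_{(ν,μ)} e((∑ 2^{ν_i} - ∑ 2^{μ_i}) α)` (the Fourier expansion
`|G_k|² = ∑_m r_{k,k}(m) e(mα)` written over pairs of tuples). [cite: PintzRuzsa2003, (9.1)–(9.2)] -/
theorem norm_sq_powSum_pow_eq (N k : ℕ) (α : ℝ) :
    ((‖powSum N α ^ k‖ ^ 2 : ℝ) : ℂ) =
      ∑ z ∈ expTuples N k ×ˢ expTuples N k,
        (𝐞 ((((tupleSum z.1 : ℤ) - tupleSum z.2 : ℤ) : ℝ) * α) : ℂ) := by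
  rw [powSum_pow, norm_sq_expSum_eq, Finset.sum_product]
  rfl

/-- `|S G^k|² = |S|² |G|^{2k}`. [folklore] -/
theorem norm_sq_primeSum_mul_powSum_pow (N k : ℕ) (α : ℝ) :
    ‖primeSum N α * powSum N α ^ k‖ ^ 2 = ‖primeSum N α‖ ^ 2 * (‖powSum N α‖ ^ 2) ^ k := by
  rw [norm_mul, norm_pow, mul_pow, ← pow_mul, ← pow_mul, mul_comm k 2]

/-! ### The major-arc piece, (10.4) -/

/-- Integrability of the twisted integrand `|S(α)|² e(cα)` on any subset of `[0,1]`. [folklore] -/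
theorem integrableOn_normSq_mul_fourierChar (N : ℕ) (c : ℝ) {A : Set ℝ}
    (hA : A ⊆ Set.Icc (0 : ℝ) 1) :
    IntegrableOn (fun α : ℝ => ((‖primeSum N α‖ ^ 2 : ℝ) : ℂ) * (𝐞 (c * α) : ℂ)) A := by
  refine (Continuous.integrableOn_Icc ?_).mono_set hA
  exact (Complex.continuous_ofReal.comp ((continuous_norm.comp (continuous_primeSum N)).pow 2)).mul
    (continuous_fourierChar_mul c)

/-- **Pintz–Ruzsa I (10.4), first equality:**
`∫_{[0,1]∩𝔐} |S G^k|² = ∑_{(ν,μ)} Re ∫_{[0,1]∩𝔐} |S(α)|² e((∑2^{ν_i} - ∑2^{μ_i})α) dα`.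
[cite: PintzRuzsa2003, (10.4)] -/
theorem setIntegral_major_eq_sum (𝔐 : Set ℝ) (N k : ℕ) :
    ∫ α in Set.Icc (0 : ℝ) 1 ∩ 𝔐, ‖primeSum N α * powSum N α ^ k‖ ^ 2 =
      ∑ z ∈ expTuples N k ×ˢ expTuples N k,
        majorArcPairIntegral 𝔐 N ((tupleSum z.1 : ℤ) - tupleSum z.2) := by
  set A : Set ℝ := Set.Icc (0 : ℝ) 1 ∩ 𝔐
  have h1 : ∀ α : ℝ, ((‖primeSum N α * powSum N α ^ k‖ ^ 2 : ℝ) : ℂ) =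
      ∑ z ∈ expTuples N k ×ˢ expTuples N k,
        ((‖primeSum N α‖ ^ 2 : ℝ) : ℂ) *
          (𝐞 ((((tupleSum z.1 : ℤ) - tupleSum z.2 : ℤ) : ℝ) * α) : ℂ) := by
    intro α
    rw [norm_mul, mul_pow, Complex.ofReal_mul, norm_sq_powSum_pow_eq, Finset.mul_sum]
  have h2 : ((∫ α in A, ‖primeSum N α * powSum N α ^ k‖ ^ 2 : ℝ) : ℂ) =
      ∑ z ∈ expTuples N k ×ˢ expTuples N k,
        ∫ α in A, ((‖primeSum N α‖ ^ 2 : ℝ) : ℂ) *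
          (𝐞 ((((tupleSum z.1 : ℤ) - tupleSum z.2 : ℤ) : ℝ) * α) : ℂ) := by
    have hfun : (fun α : ℝ => ((‖primeSum N α * powSum N α ^ k‖ ^ 2 : ℝ) : ℂ)) =
        fun α => ∑ z ∈ expTuples N k ×ˢ expTuples N k,
          ((‖primeSum N α‖ ^ 2 : ℝ) : ℂ) *
            (𝐞 ((((tupleSum z.1 : ℤ) - tupleSum z.2 : ℤ) : ℝ) * α) : ℂ) := funext h1
    rw [← integral_finsetSum _ fun z _ =>
      integrableOn_normSq_mul_fourierChar N _ Set.inter_subset_left, ← hfun]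
    exact integral_complex_ofReal.symm
  apply_fun Complex.re at h2
  rw [Complex.ofReal_re, Complex.re_sum] at h2
  rw [h2]
  rfl

/-- For a coincident pair (`m = 0`) the twisted integral is `∫_{[0,1]∩𝔐} |S|² ≤ ∫₀¹ |S|² = #{odd p ≤ N}`.
[cite: PintzRuzsa2003, (10.4)] -/
theorem majorArcPairIntegral_zero_le (𝔐 : Set ℝ) (N : ℕ) :
    majorArcPairIntegral 𝔐 N 0 ≤ (oddPrimes N).card := by
  have hint : IntegrableOn (fun α : ℝ => ‖primeSum N α‖ ^ 2) (Set.Icc (0 : ℝ) 1) :=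
    ((continuous_norm.comp (continuous_primeSum N)).pow 2).integrableOn_Icc
  have h0 : majorArcPairIntegral 𝔐 N 0 = ∫ α in Set.Icc (0 : ℝ) 1 ∩ 𝔐, ‖primeSum N α‖ ^ 2 := by
    unfold majorArcPairIntegral
    simp only [Int.cast_zero, zero_mul, AddChar.map_zero_eq_one, Circle.coe_one, mul_one]
    rw [integral_complex_ofReal, Complex.ofReal_re]
  have hpars : ∫ α in (0 : ℝ)..1, ‖primeSum N α‖ ^ 2 = (oddPrimes N).card := by
    have h := integral_norm_sq_expSum (oddPrimes N) (fun p : ℕ => p)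
    have hdiag : ((oddPrimes N ×ˢ oddPrimes N).filter fun z => z.1 = z.2) = (oddPrimes N).diag := by
      ext ⟨a, b⟩
      simp only [mem_filter, mem_product, Finset.mem_diag]
      constructor
      · rintro ⟨⟨ha, -⟩, hab⟩; exact ⟨ha, hab⟩
      · rintro ⟨ha, hab⟩; exact ⟨⟨ha, hab ▸ ha⟩, hab⟩
    rw [hdiag, Finset.diag_card] at h
    exact h
  rw [h0]
  calc ∫ α in Set.Icc (0 : ℝ) 1 ∩ 𝔐, ‖primeSum N α‖ ^ 2
      ≤ ∫ α in Set.Icc (0 : ℝ) 1, ‖primeSum N α‖ ^ 2 :=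
        setIntegral_mono_set hint (Eventually.of_forall fun _ => sq_nonneg _)
          (Eventually.of_forall Set.inter_subset_left)
    _ = ∫ α in (0 : ℝ)..1, ‖primeSum N α‖ ^ 2 := by
        rw [integral_Icc_eq_integral_Ioc, intervalIntegral.integral_of_le zero_le_one]
    _ = (oddPrimes N).card := hpars

/-- **Pintz–Ruzsa I (10.4):** `∫_{[0,1]∩𝔐} |S G^k|² ≤ r_{k,k}(0) · #{odd p ≤ N} + ∑_{(ν,μ), m ≠ 0} R_𝔐(m)`,
`m = ∑2^{ν_i} - ∑2^{μ_i}`. [cite: PintzRuzsa2003, (10.4)] -/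
theorem setIntegral_major_le (𝔐 : Set ℝ) (N k : ℕ) :
    ∫ α in Set.Icc (0 : ℝ) 1 ∩ 𝔐, ‖primeSum N α * powSum N α ^ k‖ ^ 2 ≤
      (coincidences N k : ℝ) * (oddPrimes N).card +
        ∑ z ∈ offDiagPairs N k, majorArcPairIntegral 𝔐 N ((tupleSum z.1 : ℤ) - tupleSum z.2) := by
  rw [setIntegral_major_eq_sum, ← Finset.sum_filter_add_sum_filter_not _
    (fun z => tupleSum z.1 = tupleSum z.2)]
  refine add_le_add ?_ le_rfl
  calc ∑ z ∈ (expTuples N k ×ˢ expTuples N k).filter (fun z => tupleSum z.1 = tupleSum z.2),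
        majorArcPairIntegral 𝔐 N ((tupleSum z.1 : ℤ) - tupleSum z.2)
      ≤ ∑ _z ∈ (expTuples N k ×ˢ expTuples N k).filter (fun z => tupleSum z.1 = tupleSum z.2),
        ((oddPrimes N).card : ℝ) := by
          refine Finset.sum_le_sum fun z hz => ?_
          rw [mem_filter] at hz
          rw [hz.2, sub_self]
          exact majorArcPairIntegral_zero_le 𝔐 N
    _ = (coincidences N k : ℝ) * (oddPrimes N).card := by
          rw [Finset.sum_const, nsmul_eq_mul, coincidences]

/-! ### The two minor-arc pieces, (10.5)–(10.6), and the split -/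

/-- **Pintz–Ruzsa I (10.6):** on `([0,1] ∖ 𝔐) ∩ E`, `∫ |S G^k|² ≤ |E ∩ [0,1]| · U² · L^{2k}` when
`|S| ≤ U` off `𝔐`. [cite: PintzRuzsa2003, (10.6)] -/
theorem setIntegral_minor_inter_le (𝔐 E : Set ℝ) (N k : ℕ) {U : ℝ}
    (hS : ∀ α ∈ Set.Icc (0 : ℝ) 1 \ 𝔐, ‖primeSum N α‖ ≤ U) :
    ∫ α in (Set.Icc (0 : ℝ) 1 \ 𝔐) ∩ E, ‖primeSum N α * powSum N α ^ k‖ ^ 2 ≤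
      (volume (E ∩ Set.Icc (0 : ℝ) 1)).toReal * U ^ 2 * (powLen N : ℝ) ^ (2 * k) := by
  set B : Set ℝ := (Set.Icc (0 : ℝ) 1 \ 𝔐) ∩ E
  have hBfin : volume B < ⊤ :=
    (measure_mono (Set.inter_subset_left.trans Set.sdiff_subset)).trans_lt
      (by simp [Real.volume_Icc])
  have hbound : ∀ α ∈ B, ‖‖primeSum N α * powSum N α ^ k‖ ^ 2‖ ≤ U ^ 2 * (powLen N : ℝ) ^ (2 * k) := by
    intro α hα
    rw [Real.norm_of_nonneg (sq_nonneg _), norm_sq_primeSum_mul_powSum_pow, ← pow_mul]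
    have h1 : ‖primeSum N α‖ ^ 2 ≤ U ^ 2 :=
      pow_le_pow_left₀ (norm_nonneg _) (hS α hα.1) 2
    have h2 : ‖powSum N α‖ ^ (2 * k) ≤ (powLen N : ℝ) ^ (2 * k) :=
      pow_le_pow_left₀ (norm_nonneg _) (norm_powSum_le N α) _
    exact mul_le_mul h1 h2 (by positivity) (by positivity)
  have h := norm_setIntegral_le_of_norm_le_const hBfin hbound
  rw [Real.norm_of_nonneg (integral_nonneg fun _ => sq_nonneg _)] at h
  refine h.trans ?_
  have hvol : (volume B).toReal ≤ (volume (E ∩ Set.Icc (0 : ℝ) 1)).toReal := by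
    refine ENNReal.toReal_mono ?_ (measure_mono fun α hα => ⟨hα.2, hα.1.1⟩)
    exact ((measure_mono Set.inter_subset_right).trans_lt (by simp [Real.volume_Icc])).ne
  calc U ^ 2 * (powLen N : ℝ) ^ (2 * k) * (volume B).toReal
      ≤ U ^ 2 * (powLen N : ℝ) ^ (2 * k) * (volume (E ∩ Set.Icc (0 : ℝ) 1)).toReal :=
        mul_le_mul_of_nonneg_left hvol (by positivity)
    _ = _ := by ring

/-- **Pintz–Ruzsa I (10.5):** on `([0,1] ∖ 𝔐) ∖ E`, `∫ |S G^k|² ≤ (λL)^{2k-2} ∫_{[0,1]∖𝔐} |S G|²`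
when `|G| ≤ λL` off `E` (`k ≥ 1`). [cite: PintzRuzsa2003, (10.5)] -/
theorem setIntegral_minor_diff_le {𝔐 E : Set ℝ} (h𝔐 : MeasurableSet 𝔐) (hE : MeasurableSet E)
    (N : ℕ) {k : ℕ} (hk : 1 ≤ k) {lam : ℝ} (hlam : 0 ≤ lam)
    (hG : ∀ α ∈ Set.Icc (0 : ℝ) 1 \ E, ‖powSum N α‖ ≤ lam * powLen N) :
    ∫ α in (Set.Icc (0 : ℝ) 1 \ 𝔐) \ E, ‖primeSum N α * powSum N α ^ k‖ ^ 2 ≤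
      (lam * powLen N) ^ (2 * k - 2) *
        ∫ α in Set.Icc (0 : ℝ) 1 \ 𝔐, ‖primeSum N α * powSum N α‖ ^ 2 := by
  set C : Set ℝ := (Set.Icc (0 : ℝ) 1 \ 𝔐) \ E
  have hCm : MeasurableSet C := (measurableSet_Icc.diff h𝔐).diff hE
  have hcontk : Continuous fun α : ℝ => ‖primeSum N α * powSum N α ^ k‖ ^ 2 :=
    (continuous_norm.comp ((continuous_primeSum N).mul ((continuous_powSum N).pow k))).pow 2
  have hcont1 : Continuous fun α : ℝ => ‖primeSum N α * powSum N α‖ ^ 2 :=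
    (continuous_norm.comp ((continuous_primeSum N).mul (continuous_powSum N))).pow 2
  have hsub : C ⊆ Set.Icc (0 : ℝ) 1 := Set.sdiff_subset.trans Set.sdiff_subset
  have hpt : ∀ α ∈ C, ‖primeSum N α * powSum N α ^ k‖ ^ 2 ≤
      (lam * powLen N) ^ (2 * k - 2) * ‖primeSum N α * powSum N α‖ ^ 2 := by
    intro α hα
    have hGα : ‖powSum N α‖ ≤ lam * powLen N := hG α ⟨hsub hα, hα.2⟩
    obtain ⟨j, rfl⟩ : ∃ j, k = j + 1 := ⟨k - 1, by omega⟩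
    have eq1 : ‖primeSum N α * powSum N α ^ (j + 1)‖ ^ 2 =
        ‖powSum N α‖ ^ (2 * j) * (‖primeSum N α‖ ^ 2 * ‖powSum N α‖ ^ 2) := by
      rw [norm_mul, norm_pow, mul_pow, ← pow_mul, show (j + 1) * 2 = 2 * j + 2 by ring, pow_add]
      ring
    have eq2 : ‖primeSum N α * powSum N α‖ ^ 2 = ‖primeSum N α‖ ^ 2 * ‖powSum N α‖ ^ 2 := by
      rw [norm_mul, mul_pow]
    have eq3 : 2 * (j + 1) - 2 = 2 * j := by omega
    rw [eq1, eq2, eq3]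
    exact mul_le_mul_of_nonneg_right (pow_le_pow_left₀ (norm_nonneg _) hGα _) (by positivity)
  calc ∫ α in C, ‖primeSum N α * powSum N α ^ k‖ ^ 2
      ≤ ∫ α in C, (lam * powLen N) ^ (2 * k - 2) * ‖primeSum N α * powSum N α‖ ^ 2 :=
        setIntegral_mono_on (hcontk.integrableOn_Icc.mono_set hsub)
          ((hcont1.integrableOn_Icc.mono_set hsub).const_mul _) hCm hpt
    _ = (lam * powLen N) ^ (2 * k - 2) * ∫ α in C, ‖primeSum N α * powSum N α‖ ^ 2 :=
        integral_const_mul _ _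
    _ ≤ (lam * powLen N) ^ (2 * k - 2) *
          ∫ α in Set.Icc (0 : ℝ) 1 \ 𝔐, ‖primeSum N α * powSum N α‖ ^ 2 := by
        refine mul_le_mul_of_nonneg_left ?_ (by positivity)
        exact setIntegral_mono_set (hcont1.integrableOn_Icc.mono_set Set.sdiff_subset)
          (Eventually.of_forall fun _ => sq_nonneg _) (Eventually.of_forall Set.sdiff_subset)

/-- The split `∫₀¹ = ∫_{[0,1]∩𝔐} + ∫_{([0,1]∖𝔐)∩E} + ∫_{([0,1]∖𝔐)∖E}` of the mean square.
[cite: PintzRuzsa2003, (10.3)] -/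
theorem integral_eq_three_parts {𝔐 E : Set ℝ} (h𝔐 : MeasurableSet 𝔐) (hE : MeasurableSet E)
    (N k : ℕ) :
    ∫ α in (0 : ℝ)..1, ‖primeSum N α * powSum N α ^ k‖ ^ 2 =
      (∫ α in Set.Icc (0 : ℝ) 1 ∩ 𝔐, ‖primeSum N α * powSum N α ^ k‖ ^ 2) +
      (∫ α in (Set.Icc (0 : ℝ) 1 \ 𝔐) ∩ E, ‖primeSum N α * powSum N α ^ k‖ ^ 2) +
      ∫ α in (Set.Icc (0 : ℝ) 1 \ 𝔐) \ E, ‖primeSum N α * powSum N α ^ k‖ ^ 2 := by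
  have hcont : Continuous fun α : ℝ => ‖primeSum N α * powSum N α ^ k‖ ^ 2 :=
    (continuous_norm.comp ((continuous_primeSum N).mul ((continuous_powSum N).pow k))).pow 2
  have hI : IntegrableOn (fun α : ℝ => ‖primeSum N α * powSum N α ^ k‖ ^ 2) (Set.Icc (0 : ℝ) 1) :=
    hcont.integrableOn_Icc
  rw [intervalIntegral.integral_of_le zero_le_one, ← integral_Icc_eq_integral_Ioc]
  conv_lhs => rw [← Set.inter_union_sdiff (Set.Icc (0 : ℝ) 1) 𝔐]
  rw [setIntegral_union (Set.disjoint_sdiff_right.mono_left Set.inter_subset_right)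
    (measurableSet_Icc.diff h𝔐) (hI.mono_set Set.inter_subset_left) (hI.mono_set Set.sdiff_subset)]
  conv_lhs => rw [← Set.inter_union_sdiff (Set.Icc (0 : ℝ) 1 \ 𝔐) E]
  rw [setIntegral_union (Set.disjoint_sdiff_right.mono_left Set.inter_subset_right)
    ((measurableSet_Icc.diff h𝔐).diff hE)
    (hI.mono_set (Set.inter_subset_left.trans Set.sdiff_subset))
    (hI.mono_set (Set.sdiff_subset.trans Set.sdiff_subset)), add_assoc]

/-- **Pintz–Ruzsa I, proof of Lemma 13, (10.3)–(10.6) combined** (fixed `N`, arbitrary measurable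
`𝔐`, `E`): if `|S| ≤ U` on `[0,1] ∖ 𝔐` and `|G| ≤ λL` on `[0,1] ∖ E` (`k ≥ 1`), then
`∫₀¹ |S G^k|² ≤ r_{k,k}(0) #{odd p ≤ N} + ∑_{(ν,μ): m ≠ 0} R_𝔐(m) + |E ∩ [0,1]| U² L^{2k}
  + (λL)^{2k-2} ∫_{[0,1]∖𝔐} |S G|²`. [cite: PintzRuzsa2003, Lemma 13 (proof, (10.3)–(10.6))] -/
theorem meanSquare_le_split {𝔐 E : Set ℝ} (h𝔐 : MeasurableSet 𝔐) (hE : MeasurableSet E)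
    (N : ℕ) {k : ℕ} (hk : 1 ≤ k) {U lam : ℝ} (hlam : 0 ≤ lam)
    (hS : ∀ α ∈ Set.Icc (0 : ℝ) 1 \ 𝔐, ‖primeSum N α‖ ≤ U)
    (hG : ∀ α ∈ Set.Icc (0 : ℝ) 1 \ E, ‖powSum N α‖ ≤ lam * powLen N) :
    ∫ α in (0 : ℝ)..1, ‖primeSum N α * powSum N α ^ k‖ ^ 2 ≤
      (coincidences N k : ℝ) * (oddPrimes N).card +
        ∑ z ∈ offDiagPairs N k, majorArcPairIntegral 𝔐 N ((tupleSum z.1 : ℤ) - tupleSum z.2) +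
        (volume (E ∩ Set.Icc (0 : ℝ) 1)).toReal * U ^ 2 * (powLen N : ℝ) ^ (2 * k) +
        (lam * powLen N) ^ (2 * k - 2) *
          ∫ α in Set.Icc (0 : ℝ) 1 \ 𝔐, ‖primeSum N α * powSum N α‖ ^ 2 := by
  rw [integral_eq_three_parts h𝔐 hE N k]
  exact add_le_add (add_le_add (setIntegral_major_le 𝔐 N k)
    (setIntegral_minor_inter_le 𝔐 E N k hS)) (setIntegral_minor_diff_le h𝔐 hE N hk hlam hG)

end GoldbachLinnik

end Literature.NumberTheory.Sieve
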